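import Summits.SmoothPoincare4.SmoothPoincare4.Theorems.CylinderEntropyCylinderRungTwoHamiltonMonotonicityTransport
import Literature.Geometry.Riemannian.SphericalCylinderEntropyEmbedded
import Literature.Geometry.Riemannian.SphericalCylinderEntropyKernelCalculus
import Literature.Geometry.Riemannian.SphericalCylinderEntropyZonalSmooth
import HarnessLib

/-!
# Hamilton's monotonicity along a smooth cylinder flow, part 5: the typed density as an integral
# over the parametrising manifold; right-continuity at the initial time

Part 5 of the proof of the registered stub `stub_hamiltonMonotonicity` of line `killing-flux` of the
crux `CylinderEntropy.CylinderRungTwo` (stmt-SmoothPoincare4-7631). The typed density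
`F̂_{p,τ}(A) = (μH⁴ S⁴)⁻¹ ∫⁻_A k_{p,τ} dμH⁴` (`cylDensity`, `Literature/…/SphericalCylinderEntropy.lean`)
of the embedded cross-section `A = F_t(M)` of a smooth cylinder flow `IsCylinderMCF M F ν T` is
rewritten as a Bochner integral over `M` against the area measure of `F_t^*δ` (area formula,
`riemannianMeasure_induced_apply` / `integral_comp_riemannianMeasure_induced`, `F t` injective):

* `exists_euclideanHausdorff_six_eq_smul` — `μHE⁴ = c • μH⁴` on `ℝ⁶`, `c ≠ 0`;
* `IsCylinderMCF.smul_setIntegral_range_eq`, `IsCylinderMCF.mul_setLIntegral_range_eq` —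
  `c ∫_{F_t(M)} g dμH⁴ = ∫_M g ∘ F_t dμ_t` (Bochner and `ℝ≥0∞`);
* `IsCylinderMCF.toReal_cylDensity_eq` — `F̂_{p,τ}(F_t(M)) = (μH⁴ S⁴)⁻¹ c⁻¹ ∫_M k_{p,τ} ∘ F_t dμ_t`
  as real numbers (`k > 0` on `N`, continuous);
* `IsCylinderMCF.continuousWithinAt_integral_mul_density` — **right-continuity at `T`** of
  `t ↦ ∫_M f(t, ·) θ_t dμ_T` for `f` jointly continuous on `[T, b) × M` (dominated convergence on
  the compact `M`: `0 < θ_t ≤ 1`);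
* `stub_hamiltonMonotonicity_part6` — the registered sub-goal marker (the density formula).

Everything is PROVED (no `sorry`, no new definitions, no named facts).

References: H. Federer, *Geometric Measure Theory* (1969), 3.2.3 and 3.2.46; R. S. Hamilton,
Comm. Anal. Geom. 1 (1993) 127–137, §4; C. Mantegazza, *Lecture Notes on Mean Curvature Flow*
(2011), Prop. 2.3.3.
-/

-- the prescribed namespace `Summit.SmoothPoincare4.SmoothPoincare4.…` repeats `SmoothPoincare4`
set_option linter.dupNamespace false

noncomputable section

open Bundle MeasureTheory Set Function Filter Module
open scoped Manifold ContDiff ENNReal Topology RealInnerProductSpace NNReal Matrix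

namespace Summit.SmoothPoincare4.SmoothPoincare4.Cruxes.CylinderRungTwo.KillingFlux

open Literature.Geometry.Riemannian Literature.Geometry.Riemannian.EuclideanHypersurface
open Literature.Geometry.Lorentzian Literature.Geometry.Lorentzian.PseudoRiemannianMetric
open Literature.Analysis.Calculus

section Density

open Literature.Geometry.Riemannian.SphericalCylinderEntropy (cylKernel cylDensity truncL
  cylDensity_range_lt_top contDiff_cylKernel cylKernel_pos)

variable {M : Type} [TopologicalSpace M] [ChartedSpace (EuclideanSpace ℝ (Fin 4)) M]
  [IsManifold (𝓡 4) ∞ M] {F ν : ℝ → M → EuclideanSpace ℝ (Fin 6)} {T : ℝ}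

/-- `μHE⁴ = c • μH⁴` on `ℝ⁶` for a non-zero finite constant `c` (Mathlib's normalisation of the
Euclidean Hausdorff measure `μHE`). [folklore] -/
theorem exists_euclideanHausdorff_six_eq_smul :
    ∃ c : ℝ≥0, c ≠ 0 ∧ (μHE[4] : Measure (EuclideanSpace ℝ (Fin 6))) =
      c • (μH[4] : Measure (EuclideanSpace ℝ (Fin 6))) := by
  refine ⟨_, Measure.addHaarScalarFactor_volume_hausdorffMeasure_ne_zero 4, ?_⟩
  have h := Measure.euclideanHausdorffMeasure_def (X := EuclideanSpace ℝ (Fin 6)) 4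
  refine h.trans ?_
  congr 1

variable [T2Space M] [CompactSpace M] [MeasurableSpace M] [BorelSpace M]

/-- **Integrals over the embedded cross-section are integrals over the parametrising manifold**:
for `t ≥ T`, `g : ℝ⁶ → E` and `μHE⁴ = c • μH⁴`,
`c · ∫_{F_t(M)} g dμH⁴ = ∫_M g ∘ F_t dμ_{F_t^*δ}` (tree `integral_comp_riemannianMeasure_induced`,
`F t` being injective). [cite: Federer1969, 3.2.3 and 3.2.46] -/
theorem IsCylinderMCF.smul_setIntegral_range_eq (h : IsCylinderMCF M F ν T) {t : ℝ} (ht : T ≤ t)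
    {c : ℝ≥0} (hc : (μHE[4] : Measure (EuclideanSpace ℝ (Fin 6))) =
      c • (μH[4] : Measure (EuclideanSpace ℝ (Fin 6))))
    {E : Type*} [NormedAddCommGroup E] [NormedSpace ℝ E] (g : EuclideanSpace ℝ (Fin 6) → E) :
    (c : ℝ) • ∫ z in range (F t), g z ∂μH[4] =
      ∫ w, g (F t w) ∂riemannianMeasure ((euclideanMetric (EuclideanSpace ℝ (Fin 6))).inducedRiemannianMetric
        (F t) contMDiff_pullbackBilin_holds (h.isSpacelikeImmersion t ht)) := by
  rw [integral_comp_riemannianMeasure_induced (h.isSpacelikeImmersion t ht) (h.injective ht) g, hc,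
    Measure.restrict_smul, ENNReal.smul_def, integral_smul_measure, ENNReal.coe_toReal]

/-- **`ℝ≥0∞`-valued version**: `c · ∫⁻_{F_t(M)} G dμH⁴ = ∫⁻_M G ∘ F_t dμ_{F_t^*δ}`.
[cite: Federer1969, 3.2.3 and 3.2.46] -/
theorem IsCylinderMCF.mul_setLIntegral_range_eq (h : IsCylinderMCF M F ν T) {t : ℝ} (ht : T ≤ t)
    {c : ℝ≥0} (hc : (μHE[4] : Measure (EuclideanSpace ℝ (Fin 6))) =
      c • (μH[4] : Measure (EuclideanSpace ℝ (Fin 6)))) (G : EuclideanSpace ℝ (Fin 6) → ℝ≥0∞) :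
    (c : ℝ≥0∞) * ∫⁻ z in range (F t), G z ∂μH[4] =
      ∫⁻ w, G (F t w) ∂riemannianMeasure ((euclideanMetric (EuclideanSpace ℝ (Fin 6))).inducedRiemannianMetric
        (F t) contMDiff_pullbackBilin_holds (h.isSpacelikeImmersion t ht)) := by
  rw [lintegral_comp_riemannianMeasure_induced (h.isSpacelikeImmersion t ht) (h.injective ht) G, hc,
    Measure.restrict_smul, ENNReal.smul_def, lintegral_smul_measure, smul_eq_mul]

/-- **The typed density of a cross-section as a Bochner integral over the parametrising manifold**:
for `t ≥ T`, `p ∈ N`, `τ > 0` and `μHE⁴ = c • μH⁴`,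
`F̂_{p,τ}(F_t(M)) = (μH⁴ S⁴)⁻¹ c⁻¹ ∫_M k_{p,τ} ∘ F_t dμ_{F_t^*δ}` as real numbers (the kernel is
continuous and positive on `N`, so the `ℝ≥0∞`-integral is the Bochner integral). [cite: Hamilton1993, §4] -/
theorem IsCylinderMCF.toReal_cylDensity_eq (h : IsCylinderMCF M F ν T) {t : ℝ} (ht : T ≤ t)
    {c : ℝ≥0} (hc0 : c ≠ 0) (hc : (μHE[4] : Measure (EuclideanSpace ℝ (Fin 6))) =
      c • (μH[4] : Measure (EuclideanSpace ℝ (Fin 6))))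
    {p : EuclideanSpace ℝ (Fin 6)} (hp : ∑ i : Fin 5, p (Fin.castSucc i) ^ 2 = 1) {τ : ℝ} (hτ : 0 < τ) :
    (cylDensity (range (F t)) p τ).toReal =
      ((μH[4] (Metric.sphere (0 : EuclideanSpace ℝ (Fin 5)) 1))⁻¹).toReal * (c : ℝ)⁻¹ *
        ∫ w, cylKernel p τ (F t w) ∂riemannianMeasure ((euclideanMetric (EuclideanSpace ℝ (Fin 6))).inducedRiemannianMetric
          (F t) contMDiff_pullbackBilin_holds (h.isSpacelikeImmersion t ht)) := by
  have hc0' : (c : ℝ≥0∞) ≠ 0 := ENNReal.coe_ne_zero.2 hc0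
  have hcont : Continuous fun w => cylKernel p τ (F t w) :=
    (contDiff_cylKernel p hτ).continuous.comp (h.isSpacelikeImmersion t ht).contMDiff.continuous
  have hnn : ∀ w, 0 ≤ cylKernel p τ (F t w) := fun w => (cylKernel_pos hp (h.mem_cyl t ht w) hτ).le
  have hint : Integrable (fun w => cylKernel p τ (F t w))
      (riemannianMeasure ((euclideanMetric (EuclideanSpace ℝ (Fin 6))).inducedRiemannianMetric
        (F t) contMDiff_pullbackBilin_holds (h.isSpacelikeImmersion t ht))) :=
    integrable_of_continuous (h := (euclideanMetric (EuclideanSpace ℝ (Fin 6))).inducedRiemannianMetric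
        (F t) contMDiff_pullbackBilin_holds (h.isSpacelikeImmersion t ht)) hcont
  have hlin := h.mul_setLIntegral_range_eq ht hc (fun z => ENNReal.ofReal (cylKernel p τ z))
  rw [← ofReal_integral_eq_lintegral_ofReal hint (Eventually.of_forall hnn)] at hlin
  have hlin' : ∫⁻ z in range (F t), ENNReal.ofReal (cylKernel p τ z) ∂μH[4] =
      (c : ℝ≥0∞)⁻¹ * ENNReal.ofReal (∫ w, cylKernel p τ (F t w)
        ∂riemannianMeasure ((euclideanMetric (EuclideanSpace ℝ (Fin 6))).inducedRiemannianMetric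
          (F t) contMDiff_pullbackBilin_holds (h.isSpacelikeImmersion t ht))) := by
    rw [← hlin, ← mul_assoc, ENNReal.inv_mul_cancel hc0' ENNReal.coe_ne_top, one_mul]
  rw [cylDensity, hlin', ENNReal.toReal_mul, ENNReal.toReal_mul, ENNReal.toReal_inv (c : ℝ≥0∞),
    ENNReal.coe_toReal, ENNReal.toReal_ofReal (integral_nonneg hnn), mul_assoc]

/-- **Continuity from the right at the initial time of `∫ f(t, ·) θ_t dμ_T`**: for `f` jointly
continuous on `[T, b) × M` (`b > T`), `t ↦ ∫_M f(t, w) θ_t(w) dμ_T(w)` with `θ_t = √D_t/√D_T`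
(so that `θ_t dμ_T = dμ_t`) is continuous within `[T, ∞)` at `T` (dominated convergence on the
compact `M`: `0 < θ_t ≤ θ_T = 1` for `t ≥ T`, `f` bounded on `[T, (T+b)/2] × M`).
[cite: Mantegazza2011, Prop. 2.3.3] -/
theorem IsCylinderMCF.continuousWithinAt_integral_mul_density (h : IsCylinderMCF M F ν T) {b : ℝ}
    (hb : T < b) {f : ℝ → M → ℝ} (hfc : ContinuousOn (uncurry f) (Ico T b ×ˢ univ)) :
    ContinuousWithinAt (fun t => ∫ w, f t w *
        (Real.sqrt (Matrix.of fun i j =>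
          (euclideanMetric (EuclideanSpace ℝ (Fin 6))).inducedBilin (𝓡 4) (F t) w
            ((trivializationAt (EuclideanSpace ℝ (Fin 4)) (TangentSpace (𝓡 4)) w).localFrame
              (EuclideanSpace.basisFun (Fin 4) ℝ).toBasis i w)
            ((trivializationAt (EuclideanSpace ℝ (Fin 4)) (TangentSpace (𝓡 4)) w).localFrame
              (EuclideanSpace.basisFun (Fin 4) ℝ).toBasis j w)).det /
         Real.sqrt (Matrix.of fun i j =>
          (euclideanMetric (EuclideanSpace ℝ (Fin 6))).inducedBilin (𝓡 4) (F T) w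
            ((trivializationAt (EuclideanSpace ℝ (Fin 4)) (TangentSpace (𝓡 4)) w).localFrame
              (EuclideanSpace.basisFun (Fin 4) ℝ).toBasis i w)
            ((trivializationAt (EuclideanSpace ℝ (Fin 4)) (TangentSpace (𝓡 4)) w).localFrame
              (EuclideanSpace.basisFun (Fin 4) ℝ).toBasis j w)).det)
        ∂riemannianMeasure ((euclideanMetric (EuclideanSpace ℝ (Fin 6))).inducedRiemannianMetric
          (F T) contMDiff_pullbackBilin_holds (h.isSpacelikeImmersion T le_rfl))) (Ici T) T := by
  obtain ⟨U, hU, hIU, hF⟩ := h.contMDiffOn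
  -- notation
  set g : ∀ t, T ≤ t → ContMDiffRiemannianMetric (𝓡 4) ∞ (EuclideanSpace ℝ (Fin 4))
      (TangentSpace (𝓡 4) : M → Type _) := fun t ht =>
    (euclideanMetric (EuclideanSpace ℝ (Fin 6))).inducedRiemannianMetric (F t)
      contMDiff_pullbackBilin_holds (h.isSpacelikeImmersion t ht) with hg
  set μ₀ := riemannianMeasure (g T le_rfl) with hμ₀
  haveI : IsFiniteMeasure μ₀ := isFiniteMeasure_riemannianMeasure _
  set D : ℝ → M → ℝ := fun t w => (Matrix.of fun i j =>
    (euclideanMetric (EuclideanSpace ℝ (Fin 6))).inducedBilin (𝓡 4) (F t) w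
      ((trivializationAt (EuclideanSpace ℝ (Fin 4)) (TangentSpace (𝓡 4)) w).localFrame
        (EuclideanSpace.basisFun (Fin 4) ℝ).toBasis i w)
      ((trivializationAt (EuclideanSpace ℝ (Fin 4)) (TangentSpace (𝓡 4)) w).localFrame
        (EuclideanSpace.basisFun (Fin 4) ℝ).toBasis j w)).det with hD
  set θ : ℝ → M → ℝ := fun t w => Real.sqrt (D t w) / Real.sqrt (D T w) with hθ
  set Hsq : ℝ → M → ℝ := fun t w => ‖deriv (fun s => F s w) t‖ ^ 2 with hHsq
  -- the densities: chart identification, positivity, continuity, derivative, monotonicity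
  have hDchart : ∀ t (ht : T ≤ t) w,
      chartGramMatrix (g t ht) w (extChartAt (𝓡 4) w w) = Matrix.of fun i j =>
        (euclideanMetric (EuclideanSpace ℝ (Fin 6))).inducedBilin (𝓡 4) (F t) w
          ((trivializationAt (EuclideanSpace ℝ (Fin 4)) (TangentSpace (𝓡 4)) w).localFrame
            (EuclideanSpace.basisFun (Fin 4) ℝ).toBasis i w)
          ((trivializationAt (EuclideanSpace ℝ (Fin 4)) (TangentSpace (𝓡 4)) w).localFrame
            (EuclideanSpace.basisFun (Fin 4) ℝ).toBasis j w) :=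
    fun t ht w => chartGramMatrix_inducedRiemannianMetric_self_of_immersion (h.isSpacelikeImmersion t ht) w
  have hDpos : ∀ t (ht : T ≤ t) w, 0 < Real.sqrt (D t w) := fun t ht w => by
    have := sqrt_det_chartGramMatrix_pos (g t ht) w (mem_extChartAt_target w)
    rwa [hDchart t ht w] at this
  have hθcont : ∀ t (ht : T ≤ t), Continuous (θ t) := fun t ht => by
    have hθcan : θ t = fun w =>
        Real.sqrt (chartGramMatrix (g t ht) w (extChartAt (𝓡 4) w w)).det /
          Real.sqrt (chartGramMatrix (g T le_rfl) w (extChartAt (𝓡 4) w w)).det := by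
      funext w
      simp only [hθ, hD, hDchart t ht w, hDchart T le_rfl w]
    rw [hθcan]
    exact continuous_sqrt_det_chartGramMatrix_div (g t ht) (g T le_rfl)
  have hθpos : ∀ t (ht : T ≤ t) w, 0 < θ t w := fun t ht w =>
    div_pos (hDpos t ht w) (hDpos T le_rfl w)
  have hθ₀ : ∀ w, θ T w = 1 := fun w => div_self (hDpos T le_rfl w).ne'
  have hHsqeq : ∀ t (ht : T ≤ t) w, Hsq t w = ((euclideanMetric (EuclideanSpace ℝ (Fin 6))).meanCurvature
      (F t) contMDiff_pullbackBilin_holds (h.isSpacelikeImmersion t ht) (ν t) w) ^ 2 :=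
    fun t ht w => h.norm_deriv_sq_eq ht w
  have hθd : ∀ t (ht : T ≤ t) w, HasDerivAt (fun s => θ s w) (-(Hsq t w) * θ t w) t :=
    fun t ht w => by
    have hd := (h.hasDerivAt_sqrt_det_gram_localFrame ht w).div_const (Real.sqrt (D T w))
    simp only [hθ]
    refine hd.congr_deriv ?_
    rw [hHsqeq t ht w]
    simp only [hD]
    ring
  have hθanti : ∀ w, AntitoneOn (fun s => θ s w) (Ici T) := fun w => by
    refine antitoneOn_of_hasDerivWithinAt_nonpos (convex_Ici T) (f' := fun t => -(Hsq t w) * θ t w)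
      (fun t ht => (hθd t ht w).continuousAt.continuousWithinAt)
      (fun t ht => (hθd t (interior_subset ht) w).hasDerivWithinAt) fun t ht => ?_
    have h1 := hθpos t (interior_subset ht) w
    have h2 : 0 ≤ Hsq t w := by positivity
    nlinarith
  have hθle : ∀ t, T ≤ t → ∀ w, θ t w ≤ 1 := fun t ht w => by
    rw [← hθ₀ w]; exact hθanti w (mem_Ici.2 le_rfl) (mem_Ici.2 ht) ht
  clear_value Hsq θ D
  -- a compact slab `[T, T + δ] × M` inside `[T, b) × M` and a bound for `f` on it
  obtain ⟨δ, hδ, hδb⟩ : ∃ δ > 0, T + δ < b := ⟨(b - T) / 2, by linarith, by linarith⟩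
  have hslab : Icc T (T + δ) ⊆ Ico T b := fun t ht => ⟨ht.1, lt_of_le_of_lt ht.2 hδb⟩
  have hK : IsCompact (Icc T (T + δ) ×ˢ (univ : Set M)) := isCompact_Icc.prod isCompact_univ
  obtain ⟨C₀, hC₀⟩ := hK.exists_bound_of_continuousOn (hfc.mono (Set.prod_mono hslab subset_rfl))
  have hcontt : ∀ t ∈ Ico T b, Continuous (f t) := fun t ht =>
    hfc.comp_continuous (continuous_const.prodMk continuous_id) fun y => ⟨ht, mem_univ _⟩
  have hnhds : Ico T (T + δ) ∈ 𝓝[Ici T] T := by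
    rw [mem_nhdsWithin]
    exact ⟨Iio (T + δ), isOpen_Iio, by simp [hδ], fun t ht => ⟨ht.2, ht.1⟩⟩
  have key : ContinuousWithinAt (fun t => ∫ w, f t w * θ t w ∂μ₀) (Ici T) T := by
    refine continuousWithinAt_of_dominated (bound := fun _ => C₀) ?_ ?_ (integrable_const C₀) ?_
    · filter_upwards [hnhds] with t ht
      exact ((hcontt t ⟨ht.1, lt_trans ht.2 hδb⟩).mul (hθcont t ht.1)).aestronglyMeasurable
    · filter_upwards [hnhds] with t ht
      refine Eventually.of_forall fun w => ?_
      have h0 := hC₀ (t, w) ⟨⟨ht.1, ht.2.le⟩, mem_univ _⟩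
      simp only [uncurry_apply_pair, Real.norm_eq_abs] at h0
      rw [Real.norm_eq_abs, abs_mul, abs_of_pos (hθpos t ht.1 w)]
      have hC : 0 ≤ C₀ := (abs_nonneg _).trans h0
      calc |f t w| * θ t w ≤ C₀ * 1 := mul_le_mul h0 (hθle t ht.1 w) (hθpos t ht.1 w).le hC
        _ = C₀ := mul_one _
    · refine Eventually.of_forall fun w => ?_
      have hft : ContinuousWithinAt (fun t => f t w) (Ici T) T := by
        have h1 : ContinuousWithinAt (uncurry f) (Ico T b ×ˢ univ) (T, w) :=
          hfc (T, w) ⟨⟨le_rfl, hb⟩, mem_univ _⟩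
        have h2 : ContinuousWithinAt (fun t : ℝ => (t, w)) (Ico T b) T :=
          (continuous_id.prodMk continuous_const).continuousWithinAt
        have h3 : ContinuousWithinAt (fun t => f t w) (Ico T b) T :=
          ContinuousWithinAt.comp (f := fun t : ℝ => (t, w)) (x := T) h1 h2
            (fun t ht => ⟨ht, mem_univ _⟩)
        exact h3.mono_of_mem_nhdsWithin (mem_of_superset hnhds
          (fun t ht => ⟨ht.1, lt_trans ht.2 hδb⟩))
      exact hft.mul (hθd T le_rfl w).continuousAt.continuousWithinAt
  simp only [hθ, hD] at key
  exact key

end Density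

/-- **Registered sub-goal marker `stub_hamiltonMonotonicity_part6` (the typed density of a moving
slice as a Bochner integral over the parametrising manifold).** For `IsCylinderMCF M F ν T`,
`t ≥ T`, `μHE⁴ = c • μH⁴` (`c ≠ 0`), `p ∈ N` and `τ > 0`:
`F̂_{p,τ}(F_t(M)) = (μH⁴ S⁴)⁻¹ c⁻¹ ∫_M k_{p,τ}(F_t w) dμ_t(w)` (`IsCylinderMCF.toReal_cylDensity_eq`).
[cite: Hamilton1993, §4] -/
theorem stub_hamiltonMonotonicity_part6 :
    ∀ (M : Type) [TopologicalSpace M] [ChartedSpace (EuclideanSpace ℝ (Fin 4)) M] [IsManifold (𝓡 4) ∞ M] [T2Space M] [CompactSpace M] [MeasurableSpace M] [BorelSpace M] (F : ℝ → M → EuclideanSpace ℝ (Fin 6)) (ν : ℝ → M → EuclideanSpace ℝ (Fin 6)) (T : ℝ) (h : IsCylinderMCF M F ν T) (t : ℝ) (ht : T ≤ t) (c : NNReal), c ≠ 0 → (μHE[4] : MeasureTheory.Measure (EuclideanSpace ℝ (Fin 6))) = c • (μH[4] : MeasureTheory.Measure (EuclideanSpace ℝ (Fin 6))) → ∀ (p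 : EuclideanSpace ℝ (Fin 6)), ∑ i : Fin 5, p (Fin.castSucc i) ^ 2 = 1 → ∀ (τ : ℝ), 0 < τ → (Literature.Geometry.Riemannian.SphericalCylinderEntropy.cylDensity (Set.range (F t)) p τ).toReal = ((μH[4] (Metric.sphere (0 : EuclideanSpace ℝ (Fin 5)) 1))⁻¹).toReal * (c : ℝ)⁻¹ * ∫ w, Literature.Geometry.Riemannian.SphericalCylinderEntropy.cylKernel p τ (F t w) ∂Literature.Geometry.Lorentzian.riemannianMeasure ((Literature.Geometry.Riemannian.euclideanMetric (EuclideanSpace ℝ (Fin 6))).inducedRiemannianMetric (F t) Literature.Geometry.Lorentzian.PseudoRiemannianMetric.contMDiff_pullbackBilin_holds (h.isSpacelikeImmersion t ht)) :=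
  fun _ _ _ _ _ _ _ _ _ _ _ h _ ht _ hc0 hc _ hp _ hτ => h.toReal_cylDensity_eq ht hc0 hc hp hτ

end Summit.SmoothPoincare4.SmoothPoincare4.Cruxes.CylinderRungTwo.KillingFlux

end
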